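import Summits.QuantumFields.BalabanUV.T4Continuum.Support.NE9EvaluationChannel
import Summits.QuantumFields.BalabanUV.T4Continuum.Support.NE9Lemma1Counting

/-!
# NE9Lemma1Gain — leaf S5 of the NE9 frame with the GAIN EXPONENT AS A PARAMETER: the per-creation-step profile is
# `τ k j = c_Q·ω^{k−j}` with `ω = L^{−α}`, `α > 0` THE EXPONENT OF [I] (0.29) — not `L^{−1}` — because the irrelevant packages of
# [I] §4 carry the power `(L^jη)^{4+β}` (`β` the Hölder exponent of (I.3.32)/(I.4.18), `0 < β ≤ β₀ < 1`), not `(L^jη)⁵`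
# (cell `pub-balaban`, T4-DAG §2 node U3 / §6 NE9; lineage t4-ne9-p1 = row NE9 OWNER, generation 23; located finding F-ne9p1g23-1,
# GAPS O-ne9p1g23-1; companion of `NE9Lemma1Gather` / `NE9Lemma1Counting` / `NE9Lemma1CountingEval`)

HONEST FRAMING (T4-DAG PAGE 1).  Rung (B)+1 of the FINITE-VOLUME T⁴ programme — NOT infinite volume, NOT a mass gap, NOT the
Clay problem.  NE9 (`T4OutputRate.NE9` ∧ `FadingMemory`) is a cell NEW ESTIMATE, NOT PRINTED, NOT discharged here; spine 0/9.
HONEST DEPENDENCY (cell line, verbatim): continuum YM on T⁴ ⇐ BetaPertH ∧ nine spine estimates (0/9 proved); BetaPertH ⇐ (D1)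
∧ (D4) ∧ CAP+tail; G-an2-4 gates asym, D1 and NE2/3/4.  `FlowStep.BetaPertH`, (B), (B^μ) do not occur.  [I] = [Balaban1987RG1]
(CMP **109**), [II] = [Balaban1988RG2Cluster] (CMP **116**) are quoted for TYPES only (ABSOLUTE RULE: nothing printed in the
audited series is asserted).

THE LOCATED FINDING (F-ne9p1g23-1, renders re-read as images by this seat 2026-08-20: [I] p010 = p. 258, p029 = p. 277, p037 =
p. 285, p038 = p. 286, p040 = p. 288; [II] p008, p009).  The NE9 skeleton v1.3.3 (row N2, C5) and the co-owner leaves letter the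
fading ratio as `ω = L⁻¹`, after [II] p. 8 l. 9–10 *"To bound the first sum, over □′ ⊂ □̃², we use the factor (L^jη)⁵ in (1.24).
This yields (6L)⁴L^jη, and the sum over j is bounded by 2(6L)⁴."* — but that sentence concerns the DISPLAYED family of (1.23),
the fifth-order remainder of (I.3.34).  For the other families [II] p. 8 ¶2 only says *"the terms in this expansion can be bounded
similarly as in (1.24), using the inequalities (I.4.5), (I.4.22), (I.4.36), (I.5.44) … The summation over all possible choices of
□₀, Y₀, j, X yields an expression satisfying (1.29)"* — (1.29) being j-SUMMED — and [I] prints the power that those families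
carry: p. 285 (4.18) *"|(∂_λ∂_νB_μ)(x)| < α₁(L^jη)^{2+β}, 0 ≦ β ≦ β₀ < 1,"* (Hölder norms of (3.32) only), p. 288 *"By (4.18) the last
term on the right-hand side can be estimated by ½|Γ_{x,x₃}|²α₁(L^jη)^{2+β} with a positive β. For the expression ⟨𝐄^{(3)}, B, B,
B^{(2)}⟩, with this last term inserted in the place of B^{(2)}, it implies the bound (4.22) with the power 4 + β instead of 5 in
the last factor. Hence this is an irrelevant term."*, and p. 258 (0.29)–(0.30) *"|𝐕^{(j)}(X,U_k)| ≦ O(1)(L^jη)^{4+α}exp(−κd_j(X)),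
α > 0 … = Σ_{j=1}^k O(1)(L^jη)^αM⁻⁴|T₁^{(k)}| ≦ O(1)(1 − L^{−α})⁻¹M⁻⁴|T₁^{(k)}|"*.  With the □′-count of p. 8 (≈ (6L)⁴(L^jη)⁻⁴ cubes
of π_j in □̃²) a family of power `4 + α` leaves ONE factor `(L^jη)^α` per creation step: the per-step profile of leaf S5 is
`τ k j ≤ τ̄·ω^{k−j}` with **`ω = L^{−α}`, `α ∈ (0, 1]` the exponent of (0.29)** (`= 1` for the displayed species, `= β < 1` for the
(4.30)-remainder species), and N2 reads `L^{−α} + 8·lipbar·B·(1 + cr·a)·τ̄ < 1`.  Nothing structural changes (every END of the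
frame is parametric in `ω`); the LETTER changes, and the certified N2 arithmetic must carry it.

WHAT THIS FILE PROVES (kernel, 0 sorry; all `[folklore]` bookkeeping over the abstract carriers).
* §1 `gather_atStepG` — part 1's `gather_atStep` with the gain `ℓ⁵` replaced by an arbitrary nonnegative `gain` and the □′-count
  hypothesis in the form *"card(□′)·gain ≤ c_Q·ℓ"* (print: c_Q = (6L)⁴, gain = (L^jη)^{4+α}, ℓ = (L^jη)^α).
* §2 `PieceBoundG` / `LevelCountsG` / **`channelSizeAtStepNN_pieceG`** — part 2's S5 leaf for the piece form with the gain as a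
  parameter: `ChannelSizeAtStepNN Adm (pieceChannel P) κ (weightOf P κ₁ d₀ O1 Kp) (tauOfG c_Q ℓ)`, `tauOfG c_Q ℓ k j = c_Q·ℓ k j`;
  `pieceBoundG_of_pieceBound` / `levelCountsG_of_levelCounts` recover part 2's ℓ⁵-instance (consistency).
* §3 the α-PROFILE: with `ℓ = agePow ω` (`ω^{k−j}`), `tauOfG c_Q (agePow ω) k j = c_Q·ω^{k−j}` — the END's `hτ` with EQUALITY,
  `τ̄ = c_Q`; the letter `ω = L^{−α}`: `rpow_neg_pos_lt_one` (`0 < L^{−α} < 1` for `L > 1`, `α > 0`); print's j-summed constant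
  `Σ_{j≤k} c_Q·ω^{k−j} ≤ c_Q·(1 − ω)⁻¹` (`sum_tauOfG_le`, the shape of (0.30)).
* §4 the junction with P2's `NE9EvaluationChannel` in the gain-parametric form (`kernelMass_of_levelsG`,
  `channelSizeAtStepNN_eval_of_levelsG`).
DISPLAYED (not proved, PROOF-INTERIOR of [I] §§3–5): `PieceBoundG` itself; the numerals c_Q, 8·12³, 3·2³ (hypotheses).  CAVEAT
(GAPS O-ne9p1g22-1) unchanged: the gain is the irrelevance mechanism for MARGINAL-FREE packages; a `PieceData` satisfying
`PieceBoundG` models 𝒯 ∘ P, never the bare curly bracket on all analytic families.  DISGUISE TEST: one input family, one history.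

References (TYPES only): [Balaban1987RG1] T. Bałaban, CMP **109** (1987) 249–301, (0.29)–(0.30) p. 258, (3.32) p. 277, (4.17)–(4.18)
p. 285, (4.22) p. 286, (4.30) p. 288; [Balaban1988RG2Cluster] T. Bałaban, CMP **116** (1988) 1–22, (1.24)–(1.29) pp. 7–8, (1.36) p. 9.
Summits-side NEW work (LEAN PLACEMENT RULE); imports parts 1–2 and P2's `NE9EvaluationChannel`; modifies nothing; 0 sorry.
Value = kernel bookkeeping + a located correction of the cell's rate letter, NOT summit progress.
-/

noncomputable section

namespace Summit.QuantumFields.BalabanUV.T4Continuum.NE9Lemma1Gain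

open scoped BigOperators
open MeasureTheory
open Literature.MathematicalPhysics.QuantumFieldTheory.Balaban1983to89
open Literature.MathematicalPhysics.QuantumFieldTheory.Balaban1983to89.T4OutputRate
open Literature.MathematicalPhysics.QuantumFieldTheory.Balaban1983to89.T4HistoryLipschitzRecursion
open Summit.QuantumFields.BalabanUV.T4Continuum.NE9EvaluationChannel (evalChannel EvalAdm channelSizeAtStepNN_of_kernelMass)
open Summit.QuantumFields.BalabanUV.T4Continuum.NE9Lemma1Gather (sum_le_sum_sum_of_cover)
open Summit.QuantumFields.BalabanUV.T4Continuum.NE9Lemma1Counting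

/-! ## §1 The nested sums at one creation step with the GAIN as a parameter -/

/-- **`gather_atStep` WITH A GENERAL GAIN**: terms bounded by `K·gain·e^{−κd_j(X)}·exp(−⅛(κ₁−1)d + ⅛κ₁d₀ − ½(κ₁−1)n)` and the
□′-count in the form `card(□′)·gain ≤ c_Q·ℓ` (print: c_Q = (6L)⁴, gain = (L^jη)^{4+α}, ℓ = (L^jη)^α — [I] (0.29) p. 258, p. 288;
[II] p. 8) sum to at most `K·O1·(c_Q·ℓ)·e·exp(⅛κ₁d₀)·exp(−(1/16)κ₁d)`; levels (1.26) `hX`, (1.27) `hY`, (1.28) `h0` as in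
`B13Sect1Arith.gather_129`. [cite: Balaban1988RG2Cluster, (1.24)-(1.29) pp.7-8] -/
theorem gather_atStepG {α β γ δ : Type*} (S0 : Finset α) (SY : α → Finset β) (Sq : α → β → Finset γ)
    (SX : α → β → γ → Finset δ) (T : α → β → γ → δ → ℝ) (gain cQℓ : ℝ) (dj : δ → ℝ) (n : α → β → ℝ)
    {K O1 d d0 κ κ₁ : ℝ} (hK : 0 ≤ K) (hO1 : 0 ≤ O1) (hgain : 0 ≤ gain) (hcQℓ : 0 ≤ cQℓ)
    (hT : ∀ a ∈ S0, ∀ y ∈ SY a, ∀ q ∈ Sq a y, ∀ x ∈ SX a y q,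
      T a y q x ≤ K * gain * Real.exp (-(κ * dj x)) *
        Real.exp (-(1 / 8) * (κ₁ - 1) * d + (1 / 8) * κ₁ * d0 - (1 / 2) * (κ₁ - 1) * n a y))
    (hX : ∀ a ∈ S0, ∀ y ∈ SY a, ∀ q ∈ Sq a y, ∑ x ∈ SX a y q, Real.exp (-(κ * dj x)) ≤ O1)
    (hq : ∀ a ∈ S0, ∀ y ∈ SY a, ((Sq a y).card : ℝ) * gain ≤ cQℓ)
    (hY : ∀ a ∈ S0, ∑ y ∈ SY a, Real.exp (-(1 / 2) * (κ₁ - 1) * n a y) ≤ Real.exp 1)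
    (h0 : (S0.card : ℝ) ≤ Real.exp ((1 / 16) * (κ₁ - 2) * d)) :
    ∑ a ∈ S0, ∑ y ∈ SY a, ∑ q ∈ Sq a y, ∑ x ∈ SX a y q, T a y q x
      ≤ K * O1 * cQℓ * Real.exp 1 * Real.exp ((1 / 8) * κ₁ * d0) * Real.exp (-(1 / 16) * κ₁ * d) := by
  set A := Real.exp (-(1 / 8) * (κ₁ - 1) * d + (1 / 8) * κ₁ * d0) with hA
  have hA0 : 0 < A := Real.exp_pos _
  have hsplit : ∀ a y, Real.exp (-(1 / 8) * (κ₁ - 1) * d + (1 / 8) * κ₁ * d0 - (1 / 2) * (κ₁ - 1) * n a y)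
      = A * Real.exp (-(1 / 2) * (κ₁ - 1) * n a y) := by
    intro a y; rw [hA, ← Real.exp_add]; ring_nf
  have hLX : ∀ a ∈ S0, ∀ y ∈ SY a, ∀ q ∈ Sq a y,
      ∑ x ∈ SX a y q, T a y q x ≤ K * gain * O1 * (A * Real.exp (-(1 / 2) * (κ₁ - 1) * n a y)) := by
    intro a ha y hy q hq'
    calc ∑ x ∈ SX a y q, T a y q x
        ≤ ∑ x ∈ SX a y q, K * gain * Real.exp (-(κ * dj x)) * (A * Real.exp (-(1 / 2) * (κ₁ - 1) * n a y)) :=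
          Finset.sum_le_sum fun x hx => by rw [← hsplit]; exact hT a ha y hy q hq' x hx
      _ = K * gain * (A * Real.exp (-(1 / 2) * (κ₁ - 1) * n a y)) * ∑ x ∈ SX a y q, Real.exp (-(κ * dj x)) := by
          rw [Finset.mul_sum]; exact Finset.sum_congr rfl fun x _ => by ring
      _ ≤ K * gain * (A * Real.exp (-(1 / 2) * (κ₁ - 1) * n a y)) * O1 :=
          mul_le_mul_of_nonneg_left (hX a ha y hy q hq') (mul_nonneg (mul_nonneg hK hgain) (by positivity))
      _ = _ := by ring
  have hLq : ∀ a ∈ S0, ∀ y ∈ SY a,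
      ∑ q ∈ Sq a y, ∑ x ∈ SX a y q, T a y q x ≤ K * O1 * cQℓ * (A * Real.exp (-(1 / 2) * (κ₁ - 1) * n a y)) := by
    intro a ha y hy
    calc ∑ q ∈ Sq a y, ∑ x ∈ SX a y q, T a y q x
        ≤ (Sq a y).card * (K * gain * O1 * (A * Real.exp (-(1 / 2) * (κ₁ - 1) * n a y))) :=
          B13Sect1Arith.sum_le_card_mul _ _ _ fun q hq' => hLX a ha y hy q hq'
      _ = K * O1 * (((Sq a y).card : ℝ) * gain) * (A * Real.exp (-(1 / 2) * (κ₁ - 1) * n a y)) := by ring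
      _ ≤ K * O1 * cQℓ * (A * Real.exp (-(1 / 2) * (κ₁ - 1) * n a y)) :=
          mul_le_mul_of_nonneg_right (mul_le_mul_of_nonneg_left (hq a ha y hy) (mul_nonneg hK hO1)) (by positivity)
  have hLY : ∀ a ∈ S0, ∑ y ∈ SY a, ∑ q ∈ Sq a y, ∑ x ∈ SX a y q, T a y q x
      ≤ K * O1 * cQℓ * A * Real.exp 1 := by
    intro a ha
    calc ∑ y ∈ SY a, ∑ q ∈ Sq a y, ∑ x ∈ SX a y q, T a y q x
        ≤ ∑ y ∈ SY a, K * O1 * cQℓ * (A * Real.exp (-(1 / 2) * (κ₁ - 1) * n a y)) :=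
          Finset.sum_le_sum fun y hy => hLq a ha y hy
      _ = K * O1 * cQℓ * A * ∑ y ∈ SY a, Real.exp (-(1 / 2) * (κ₁ - 1) * n a y) := by
          rw [Finset.mul_sum]; exact Finset.sum_congr rfl fun y _ => by ring
      _ ≤ K * O1 * cQℓ * A * Real.exp 1 :=
          mul_le_mul_of_nonneg_left (hY a ha) (mul_nonneg (mul_nonneg (mul_nonneg hK hO1) hcQℓ) hA0.le)
  have hP : 0 ≤ K * O1 * cQℓ * A * Real.exp 1 :=
    mul_nonneg (mul_nonneg (mul_nonneg (mul_nonneg hK hO1) hcQℓ) hA0.le) (Real.exp_pos _).le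
  calc ∑ a ∈ S0, ∑ y ∈ SY a, ∑ q ∈ Sq a y, ∑ x ∈ SX a y q, T a y q x
      ≤ S0.card * (K * O1 * cQℓ * A * Real.exp 1) := B13Sect1Arith.sum_le_card_mul _ _ _ hLY
    _ ≤ Real.exp ((1 / 16) * (κ₁ - 2) * d) * (K * O1 * cQℓ * A * Real.exp 1) := mul_le_mul_of_nonneg_right h0 hP
    _ = K * O1 * cQℓ * Real.exp 1 * (A * Real.exp ((1 / 16) * (κ₁ - 2) * d)) := by ring
    _ = _ := by rw [hA, B13Sect1Arith.exponent_129]; ring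

/-! ## §2 Leaf S5 for the piece form with the gain as a parameter -/

variable {C : Carriers} {Bg ι α β γ : Type}

/-- **THE DISPLAYED PER-PIECE BOUND WITH A GENERAL GAIN** (binder; PROOF-INTERIOR of [I] §§3–5, NOT proved here): as
`NE9Lemma1Counting.PieceBound` with `ℓ k j⁵` replaced by `gain k j` — print's per-family powers `(L^jη)⁵` ([II] (1.24) p. 7, the
fifth-order remainder) resp. `(L^jη)^{4+β}` ([I] p. 288, the (4.30)-remainder species), i.e. `(L^jη)^{4+α}` with the α of (0.29).
CAVEAT (GAPS O-ne9p1g22-1): false for the bare curly bracket of a marginal input. [cite: Balaban1987RG1, (0.29) p.258 and (4.18) p.285] -/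
def PieceBoundG (P : PieceData C Bg ι α β γ) (κ κ₁ d0 : ℝ) (Kp : ℕ → ι → ℝ) (gain : ℕ → ℕ → ℝ) : Prop :=
  ∀ (k : ℕ) (s : ℕ → ℝ) (y : ι), ∀ a ∈ P.S0 k y, ∀ b ∈ P.SY k y a, ∀ (j : ℕ), ∀ x ∈ P.src k y a j,
    ∀ (f : Bg → ℝ) (N : ℝ), 0 ≤ N → (∀ U : Bg, |f U| ≤ Real.exp (-(κ * C.d x)) * N) →
      |P.piece k s y a b x f| ≤ Kp k y * N * gain k j * Real.exp (-(κ * C.d x)) *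
        Real.exp (-(1 / 8) * (κ₁ - 1) * P.dY k y + (1 / 8) * κ₁ * d0 - (1 / 2) * (κ₁ - 1) * P.vol k y a b)

/-- **THE LEVEL COUNTS WITH A GENERAL GAIN** (binders; the paper's numerals, as in `B13Sect1Arith.gather_129`): as
`NE9Lemma1Counting.LevelCounts` with the □′-count in the form `card(□′)·gain k j ≤ c_Q·ℓ k j` (print: ≈ (6L)⁴(L^jη)⁻⁴ cubes
□′ ∈ π_j in □̃² times the gain `(L^jη)^{4+α}` = (6L)⁴·(L^jη)^α, [II] p. 8 with [I] (0.29)–(0.30) p. 258).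
[cite: Balaban1988RG2Cluster, (1.26)-(1.28) p.8] -/
structure LevelCountsG (P : PieceData C Bg ι α β γ) (κ κ₁ O1 cQ : ℝ) (gain ℓ : ℕ → ℕ → ℝ) : Prop where
  cover : ∀ k y a j, ∀ x ∈ P.src k y a j, ∃ q ∈ P.Sq k y a j, x ∈ P.SX k y a j q
  sumX : ∀ k y a j, ∀ q ∈ P.Sq k y a j, ∑ x ∈ P.SX k y a j q, Real.exp (-(κ * C.d x)) ≤ O1
  countQ : ∀ k y a j, ((P.Sq k y a j).card : ℝ) * gain k j ≤ cQ * ℓ k j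
  sumY : ∀ k y, ∀ a ∈ P.S0 k y, ∑ b ∈ P.SY k y a, Real.exp (-(1 / 2) * (κ₁ - 1) * P.vol k y a b) ≤ Real.exp 1
  count0 : ∀ k y, ((P.S0 k y).card : ℝ) ≤ Real.exp ((1 / 16) * (κ₁ - 2) * P.dY k y)

/-- The per-creation-step constant with a general count: `τ k j = c_Q·ℓ k j`. [folklore] -/
def tauOfG (cQ : ℝ) (ℓ : ℕ → ℕ → ℝ) : ℕ → ℕ → ℝ := fun k j => cQ * ℓ k j

/-- Part 2's ℓ⁵-instance IS the case `gain = ℓ⁵` of the general binder. [folklore] -/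
theorem pieceBoundG_of_pieceBound {P : PieceData C Bg ι α β γ} {κ κ₁ d0 : ℝ} {Kp : ℕ → ι → ℝ} {ℓ : ℕ → ℕ → ℝ}
    (h : PieceBound P κ κ₁ d0 Kp ℓ) : PieceBoundG P κ κ₁ d0 Kp (fun k j => ℓ k j ^ 5) :=
  fun k s y a ha b hb j x hx f N hN hf => h k s y a ha b hb j x hx f N hN hf

/-- Part 2's level counts ARE the case `gain = ℓ⁵`, `c_Q = (6L)⁴`. [folklore] -/
theorem levelCountsG_of_levelCounts {P : PieceData C Bg ι α β γ} {κ κ₁ O1 L : ℝ} {ℓ : ℕ → ℕ → ℝ}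
    (h : LevelCounts P κ κ₁ O1 L ℓ) : LevelCountsG P κ κ₁ O1 ((6 * L) ^ 4) (fun k j => ℓ k j ^ 5) ℓ :=
  ⟨h.cover, h.sumX, h.countQ, h.sumY, h.count0⟩

/-- `tauOf L ℓ = tauOfG (6L)⁴ ℓ`. [folklore] -/
theorem tauOf_eq_tauOfG (L : ℝ) (ℓ : ℕ → ℕ → ℝ) : tauOf L ℓ = tauOfG ((6 * L) ^ 4) ℓ := rfl

/-- The levels applied to one creation step of a piece family, general gain (`gather_atStepG` after the □′-cover). [folklore] -/
theorem levels_boundG (P : PieceData C Bg ι α β γ) {κ κ₁ d0 O1 cQ K : ℝ} {gain ℓ : ℕ → ℕ → ℝ}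
    (hL : LevelCountsG P κ κ₁ O1 cQ gain ℓ) (hK : 0 ≤ K) (hO1 : 0 ≤ O1) (hgain : ∀ k j, 0 ≤ gain k j)
    (hcQℓ : ∀ k j, 0 ≤ cQ * ℓ k j) (k : ℕ) (y : ι) (j : ℕ) (g : α → β → C.Dom → ℝ)
    (hg0 : ∀ a ∈ P.S0 k y, ∀ b ∈ P.SY k y a, ∀ x ∈ P.src k y a j, 0 ≤ g a b x)
    (hg : ∀ a ∈ P.S0 k y, ∀ b ∈ P.SY k y a, ∀ x ∈ P.src k y a j,
      g a b x ≤ K * gain k j * Real.exp (-(κ * C.d x)) *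
        Real.exp (-(1 / 8) * (κ₁ - 1) * P.dY k y + (1 / 8) * κ₁ * d0 - (1 / 2) * (κ₁ - 1) * P.vol k y a b)) :
    ∑ a ∈ P.S0 k y, ∑ b ∈ P.SY k y a, ∑ x ∈ P.src k y a j, g a b x
      ≤ K * O1 * (cQ * ℓ k j) * Real.exp 1 * Real.exp ((1 / 8) * κ₁ * d0) * Real.exp (-(1 / 16) * κ₁ * P.dY k y) := by
  classical
  let g' : α → β → C.Dom → ℝ := fun a b x => if x ∈ P.src k y a j then g a b x else 0
  have hg'0 : ∀ a ∈ P.S0 k y, ∀ b ∈ P.SY k y a, ∀ x, 0 ≤ g' a b x := by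
    intro a ha b hb x
    simp only [g']
    split_ifs with h
    · exact hg0 a ha b hb x h
    · exact le_rfl
  have h1 : ∑ a ∈ P.S0 k y, ∑ b ∈ P.SY k y a, ∑ x ∈ P.src k y a j, g a b x
      ≤ ∑ a ∈ P.S0 k y, ∑ b ∈ P.SY k y a, ∑ q ∈ P.Sq k y a j, ∑ x ∈ P.SX k y a j q, g' a b x := by
    refine Finset.sum_le_sum fun a ha => Finset.sum_le_sum fun b hb => ?_
    have he : ∑ x ∈ P.src k y a j, g a b x = ∑ x ∈ P.src k y a j, g' a b x :=
      Finset.sum_congr rfl fun x hx => by simp only [g', if_pos hx]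
    rw [he]
    exact sum_le_sum_sum_of_cover _ _ _ _ (hg'0 a ha b hb) (hL.cover k y a j)
  have h2 := gather_atStepG (P.S0 k y) (P.SY k y) (fun a _ => P.Sq k y a j) (fun a _ q => P.SX k y a j q)
    (fun a b _ x => g' a b x) (gain k j) (cQ * ℓ k j) C.d (P.vol k y) (K := K) (O1 := O1) (d := P.dY k y)
    (d0 := d0) (κ := κ) (κ₁ := κ₁) hK hO1 (hgain k j) (hcQℓ k j)
    (fun a ha b hb q _ x _ => by
      simp only [g']
      split_ifs with h
      · exact hg a ha b hb x h
      · exact mul_nonneg (mul_nonneg (mul_nonneg hK (hgain k j)) (Real.exp_pos _).le) (Real.exp_pos _).le)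
    (fun a _ b _ q hq => hL.sumX k y a j q hq) (fun a _ b _ => hL.countQ k y a j) (hL.sumY k y) (hL.count0 k y)
  exact h1.trans h2

/-- **LEAF S5 FOR THE PIECE FORM, GAIN-PARAMETRIC**: `ChannelSizeAtStepNN Adm (pieceChannel P) κ (weightOf P κ₁ d₀ O1 Kp)
(tauOfG c_Q ℓ)` on ANY class from the displayed `PieceBoundG`, the source discipline and the level counts `LevelCountsG`.
With print's letters: gain = (L^jη)^{4+α}, c_Q = (6L)⁴, ℓ = (L^jη)^α, α the exponent of [I] (0.29).
[cite: Balaban1988RG2Cluster, (1.24)-(1.29) pp.7-8, (1.36) p.9] -/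
theorem channelSizeAtStepNN_pieceG {P : PieceData C Bg ι α β γ} {κ κ₁ d0 O1 cQ : ℝ} {Kp : ℕ → ι → ℝ}
    {gain ℓ : ℕ → ℕ → ℝ} (hsrc : SrcScale P) (hPiece : PieceBoundG P κ κ₁ d0 Kp gain)
    (hL : LevelCountsG P κ κ₁ O1 cQ gain ℓ) (hKp : ∀ k y, 0 ≤ Kp k y) (hO1 : 0 ≤ O1) (hgain : ∀ k j, 0 ≤ gain k j)
    (hcQℓ : ∀ k j, 0 ≤ cQ * ℓ k j) (Adm : Set (Bg → C.Dom → ℝ)) :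
    ChannelSizeAtStepNN Adm (pieceChannel P) κ (weightOf P κ₁ d0 O1 Kp) (tauOfG cQ ℓ) := by
  intro k j hjk s H _ hsupp N hN hbd y
  rw [pieceChannel_of_supported hsrc hjk s hsupp y]
  have h1 : |stepBlock P k s H y j| ≤ ∑ a ∈ P.S0 k y, ∑ b ∈ P.SY k y a,
      ∑ x ∈ P.src k y a j, |P.piece k s y a b x (fun U => H U x)| := by
    simp only [stepBlock]
    refine (Finset.abs_sum_le_sum_abs _ _).trans (Finset.sum_le_sum fun a _ => ?_)
    refine (Finset.abs_sum_le_sum_abs _ _).trans (Finset.sum_le_sum fun b _ => ?_)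
    exact Finset.abs_sum_le_sum_abs _ _
  have h2 := levels_boundG P hL (mul_nonneg (hKp k y) hN) hO1 hgain hcQℓ k y j
    (fun a b x => |P.piece k s y a b x (fun U => H U x)|) (fun a _ b _ x _ => abs_nonneg _)
    (fun a ha b hb x hx =>
      hPiece k s y a ha b hb j x hx (fun U => H U x) N hN (fun U => hbd U x (hsrc k y a j x hx)))
  calc |stepBlock P k s H y j| ≤ _ := h1
    _ ≤ Kp k y * N * O1 * (cQ * ℓ k j) * Real.exp 1 * Real.exp ((1 / 8) * κ₁ * d0) *
          Real.exp (-(1 / 16) * κ₁ * P.dY k y) := h2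
    _ = weightOf P κ₁ d0 O1 Kp k y * (tauOfG cQ ℓ k j * N) := by
        simp only [weightOf, tauOfG]; ring

/-! ## §3 The α-PROFILE: `τ k j = c_Q·ω^{k−j}`, `ω = L^{−α}` with the exponent α of [I] (0.29) -/

/-- The age power `ω^{k−j}` (truncated subtraction; only `j ≤ k` is ever used by the binder). [folklore] -/
def agePow (ω : ℝ) : ℕ → ℕ → ℝ := fun k j => ω ^ (k - j)

/-- `0 ≤ agePow ω k j` for `0 ≤ ω`. [folklore] -/
theorem agePow_nonneg {ω : ℝ} (hω : 0 ≤ ω) (k j : ℕ) : 0 ≤ agePow ω k j := pow_nonneg hω _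

/-- **THE END's PROFILE BINDER WITH EQUALITY**: `tauOfG c_Q (agePow ω) k j = c_Q·ω^{k−j}` — `hτ : τ k j ≤ τ̄·ω^{k−j}` with
`τ̄ = c_Q`. [folklore] -/
theorem tauOfG_agePow (cQ ω : ℝ) (k j : ℕ) : tauOfG cQ (agePow ω) k j = cQ * ω ^ (k - j) := rfl

/-- The profile binders of the END (`hτ`, `hω`, `hτbar`) for the gain-parametric leaf, packaged. [folklore] -/
theorem profileG {cQ ω : ℝ} (hcQ : 0 ≤ cQ) (hω : 0 ≤ ω) :
    (∀ k j : ℕ, j ≤ k → tauOfG cQ (agePow ω) k j ≤ cQ * ω ^ (k - j)) ∧ 0 ≤ ω ∧ 0 ≤ cQ :=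
  ⟨fun k j _ => (tauOfG_agePow cQ ω k j).le, hω, hcQ⟩

/-- **THE LETTER `ω = L^{−α}`**: for `L > 1` and `α > 0`, `0 < L^{−α} < 1` (real power) — the ratio of [I] (0.30)
*"≦ O(1)(1 − L^{−α})⁻¹M⁻⁴|T₁^{(k)}|"*; `α = 1` recovers the skeleton's former letter `L⁻¹`, `α = β < 1` is the (4.30)-species'.
[cite: Balaban1987RG1, (0.30) p.258] -/
theorem rpow_neg_pos_lt_one {L a : ℝ} (hL : 1 < L) (ha : 0 < a) : 0 < L ^ (-a) ∧ L ^ (-a) < 1 :=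
  ⟨Real.rpow_pos_of_pos (by linarith) _, Real.rpow_lt_one_of_one_lt_of_neg hL (by linarith)⟩

/-- With `α = 1` the letter is the former one: `L^{−1} = L⁻¹` (real power at `−1`). [folklore] -/
theorem rpow_neg_one_eq_inv {L : ℝ} (hL : 0 < L) : L ^ (-(1:ℝ)) = L⁻¹ := by
  rw [Real.rpow_neg hL.le, Real.rpow_one]

/-- The displayed species' factor is an instance of the age power: part 2's `ellPrinted L k j = L^j·(L^k)⁻¹` equals
`agePow L⁻¹ k j` for `j ≤ k`. [folklore] -/
theorem ellPrinted_eq_agePow {L : ℝ} (hL : L ≠ 0) {k j : ℕ} (hjk : j ≤ k) : ellPrinted L k j = agePow L⁻¹ k j :=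
  ellPrinted_eq_pow hL hjk

/-- **PRINT's j-SUMMED CONSTANT IN THE GENERAL CASE**: `Σ_{j≤k} c_Q·ω^{k−j} ≤ c_Q·(1 − ω)⁻¹` for `0 ≤ ω < 1` — the shape of
[I] (0.30) (*"Σ_{j=1}^k O(1)(L^jη)^α … ≦ O(1)(1 − L^{−α})⁻¹ …"*) and of the "absolute constant C₁" of [II] (1.36) for a family
of exponent α. [cite: Balaban1987RG1, (0.30) p.258] -/
theorem sum_tauOfG_le {cQ ω : ℝ} (hcQ : 0 ≤ cQ) (hω0 : 0 ≤ ω) (hω1 : ω < 1) (k : ℕ) :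
    ∑ j ∈ Finset.range (k + 1), tauOfG cQ (agePow ω) k j ≤ cQ * (1 - ω)⁻¹ := by
  have hgeom : HasSum (fun n : ℕ => ω ^ n) (1 - ω)⁻¹ := hasSum_geometric_of_lt_one hω0 hω1
  have hrefl : ∑ j ∈ Finset.range (k + 1), ω ^ (k - j) = ∑ m ∈ Finset.range (k + 1), ω ^ m := by
    rw [← Finset.sum_range_reflect (fun m => ω ^ m) (k + 1)]
    refine Finset.sum_congr rfl fun j hj => ?_
    rw [Finset.mem_range] at hj
    congr 1
  have htail : ∑ m ∈ Finset.range (k + 1), ω ^ m ≤ (1 - ω)⁻¹ :=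
    sum_le_hasSum _ (fun n _ => pow_nonneg hω0 n) hgeom
  calc ∑ j ∈ Finset.range (k + 1), tauOfG cQ (agePow ω) k j
      = cQ * ∑ j ∈ Finset.range (k + 1), ω ^ (k - j) := by
        rw [Finset.mul_sum]; rfl
    _ ≤ cQ * (1 - ω)⁻¹ := by rw [hrefl]; exact mul_le_mul_of_nonneg_left htail hcQ

/-- **THE S5 LEAF WITH THE α-PROFILE, PACKAGED**: size binder with `τ k j = c_Q·ω^{k−j}` + the END's profile binders, for any
`0 ≤ ω` (instantiate `ω := L^{−α}`, `rpow_neg_pos_lt_one`).  The level count is then asked in the form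
`card(□′)·gain k j ≤ c_Q·ω^{k−j}`. [folklore] -/
theorem channelSizeAtStepNN_pieceG_profile {P : PieceData C Bg ι α β γ} {κ κ₁ d0 O1 cQ ω : ℝ} {Kp : ℕ → ι → ℝ}
    {gain : ℕ → ℕ → ℝ} (hsrc : SrcScale P) (hPiece : PieceBoundG P κ κ₁ d0 Kp gain)
    (hL : LevelCountsG P κ κ₁ O1 cQ gain (agePow ω)) (hKp : ∀ k y, 0 ≤ Kp k y) (hO1 : 0 ≤ O1)
    (hgain : ∀ k j, 0 ≤ gain k j) (hcQ : 0 ≤ cQ) (hω : 0 ≤ ω) (Adm : Set (Bg → C.Dom → ℝ)) :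
    ChannelSizeAtStepNN Adm (pieceChannel P) κ (weightOf P κ₁ d0 O1 Kp) (tauOfG cQ (agePow ω)) ∧
      (∀ k j : ℕ, j ≤ k → tauOfG cQ (agePow ω) k j ≤ cQ * ω ^ (k - j)) ∧ 0 ≤ ω ∧ 0 ≤ cQ :=
  ⟨channelSizeAtStepNN_pieceG hsrc hPiece hL hKp hO1 hgain (fun k j => mul_nonneg hcQ (agePow_nonneg hω k j)) Adm,
    profileG hcQ hω⟩

/-! ## §4 The junction with P2's `NE9EvaluationChannel`, gain-parametric -/

section Eval

variable {Ω : Type*} [MeasurableSpace Ω]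
  {F : ℕ → (ℕ → ℝ) → ι → Finset C.Dom} {ν : ℕ → (ℕ → ℝ) → ι → C.Dom → Measure Ω}
  {w : ℕ → (ℕ → ℝ) → ι → C.Dom → Ω → ℝ} {bg : ℕ → (ℕ → ℝ) → ι → C.Dom → Ω → Bg}

/-- P2's kernel-mass hypothesis from per-piece masses of the general-gain shape + the counts (cf. part 3's
`kernelMass_of_levels`). [cite: Balaban1988RG2Cluster, (1.24)-(1.28) pp.7-8] -/
theorem kernelMass_of_levelsG (P : PieceData C Bg ι α β γ) {κ κ₁ d0 O1 cQ : ℝ} {Kp : ℕ → ι → ℝ}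
    {gain ℓ : ℕ → ℕ → ℝ} (m : ℕ → (ℕ → ℝ) → ι → α → β → C.Dom → ℝ)
    (hdom : ∀ (k j : ℕ) (s : ℕ → ℝ) (y : ι),
      ∑ X ∈ (F k s y).filter (fun X => C.scale X = j), Real.exp (-(κ * C.d X)) * ∫ ω, |w k s y X ω| ∂(ν k s y X)
        ≤ ∑ a ∈ P.S0 k y, ∑ b ∈ P.SY k y a, ∑ x ∈ P.src k y a j, m k s y a b x)
    (hm : ∀ (k : ℕ) (s : ℕ → ℝ) (y : ι), ∀ a ∈ P.S0 k y, ∀ b ∈ P.SY k y a, ∀ (j : ℕ), ∀ x ∈ P.src k y a j,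
      0 ≤ m k s y a b x ∧ m k s y a b x ≤ Kp k y * gain k j * Real.exp (-(κ * C.d x)) *
        Real.exp (-(1 / 8) * (κ₁ - 1) * P.dY k y + (1 / 8) * κ₁ * d0 - (1 / 2) * (κ₁ - 1) * P.vol k y a b))
    (hL : LevelCountsG P κ κ₁ O1 cQ gain ℓ) (hKp : ∀ k y, 0 ≤ Kp k y) (hO1 : 0 ≤ O1) (hgain : ∀ k j, 0 ≤ gain k j)
    (hcQℓ : ∀ k j, 0 ≤ cQ * ℓ k j) (k j : ℕ) (s : ℕ → ℝ) (y : ι) :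
    ∑ X ∈ (F k s y).filter (fun X => C.scale X = j), Real.exp (-(κ * C.d X)) * ∫ ω, |w k s y X ω| ∂(ν k s y X)
      ≤ weightOf P κ₁ d0 O1 Kp k y * tauOfG cQ ℓ k j := by
  have h := levels_boundG P hL (hKp k y) hO1 hgain hcQℓ k y j (fun a b x => m k s y a b x)
    (fun a ha b hb x hx => (hm k s y a ha b hb j x hx).1) (fun a ha b hb x hx => (hm k s y a ha b hb j x hx).2)
  refine (hdom k j s y).trans (h.trans (le_of_eq ?_))
  simp only [weightOf, tauOfG]; ring

/-- P2's S5 leaf with its mass hypothesis discharged by the general-gain levels. [folklore] -/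
theorem channelSizeAtStepNN_eval_of_levelsG (P : PieceData C Bg ι α β γ) {κ κ₁ d0 O1 cQ : ℝ} {Kp : ℕ → ι → ℝ}
    {gain ℓ : ℕ → ℕ → ℝ} (m : ℕ → (ℕ → ℝ) → ι → α → β → C.Dom → ℝ)
    (hw : ∀ k s y, ∀ X ∈ F k s y, Integrable (w k s y X) (ν k s y X))
    (hdom : ∀ (k j : ℕ) (s : ℕ → ℝ) (y : ι),
      ∑ X ∈ (F k s y).filter (fun X => C.scale X = j), Real.exp (-(κ * C.d X)) * ∫ ω, |w k s y X ω| ∂(ν k s y X)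
        ≤ ∑ a ∈ P.S0 k y, ∑ b ∈ P.SY k y a, ∑ x ∈ P.src k y a j, m k s y a b x)
    (hm : ∀ (k : ℕ) (s : ℕ → ℝ) (y : ι), ∀ a ∈ P.S0 k y, ∀ b ∈ P.SY k y a, ∀ (j : ℕ), ∀ x ∈ P.src k y a j,
      0 ≤ m k s y a b x ∧ m k s y a b x ≤ Kp k y * gain k j * Real.exp (-(κ * C.d x)) *
        Real.exp (-(1 / 8) * (κ₁ - 1) * P.dY k y + (1 / 8) * κ₁ * d0 - (1 / 2) * (κ₁ - 1) * P.vol k y a b))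
    (hL : LevelCountsG P κ κ₁ O1 cQ gain ℓ) (hKp : ∀ k y, 0 ≤ Kp k y) (hO1 : 0 ≤ O1) (hgain : ∀ k j, 0 ≤ gain k j)
    (hcQℓ : ∀ k j, 0 ≤ cQ * ℓ k j) :
    ChannelSizeAtStepNN (EvalAdm F ν w bg) (evalChannel F ν w bg) κ (weightOf P κ₁ d0 O1 Kp) (tauOfG cQ ℓ) :=
  channelSizeAtStepNN_of_kernelMass hw fun k j s y =>
    kernelMass_of_levelsG P m hdom hm hL hKp hO1 hgain hcQℓ k j s y

end Eval

end Summit.QuantumFields.BalabanUV.T4Continuum.NE9Lemma1Gain
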